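import Literature.NumberTheory.Weil1964.AdelicThetaTensorRep
import Mathlib.Analysis.Calculus.Deriv.Slope
import HarnessLib

/-!
# The archimedean slice of the theta distribution and differentiation of theta kernels

For a fixed finite Schwartz–Bruhat factor `Ψ_f ∈ 𝒮((𝔸_{F,f})ⁿ)` the map

  `Λ_{Ψ_f} : 𝒮((F ⊗ ℝ)ⁿ) → ℂ`,  `Φ_∞ ↦ Θ(Φ_∞ ⊗ Ψ_f) = Σ_{ξ ∈ Fⁿ} Φ_∞(ξ_∞) Ψ_f(ξ_f)`

is a CONTINUOUS LINEAR FUNCTIONAL on the archimedean Schwartz space (`thetaSliceCLM`): the bound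
`|Θ(Φ_∞ ⊗ Ψ_f)| ≤ C(Ψ_f) · sup_{m ≤ (k,0)} p_m(Φ_∞)` with `k = ⌊n[F:ℚ]⌋ + 1` comes from Weil's Lemme 5 in the
form `exists_summable_majorant_of_decay` of `AdelicThetaMajorants` (one summable majorant over `Fⁿ` for
all functions with a fixed decay constant and a fixed compact set of finite parts) and the elementary decay
`|Φ_∞(x)| ≤ 2^k sup_{m ≤ (k,0)} p_m(Φ_∞) (1 + ‖x‖)^{-k}` of Schwartz functions.

Consequences (§2): for the adelic representation `ω = ω_∞ ⊗ ω_f` (`adelicRep`) and a pure tensor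
`Φ = Φ_∞ ⊗ Φ_f`, the theta kernel is `θ_Φ(g_∞, g_f) = Λ_{ω_f(g_f)Φ_f}(ω_∞(g_∞)Φ_∞)`
(`thetaDistLM_adelicRep_tmul`), so every statement about `g_∞ ↦ ω_∞(g_∞)Φ_∞` IN THE SCHWARTZ TOPOLOGY
transfers to `θ_Φ`: a continuous linear functional maps slope limits to derivatives
(`hasDerivAt_comp_of_tendsto_slope`), whence **`hasDerivAt_thetaDistLM_adelicRep_tmul`**: if
`t ↦ ω_∞(γ(t))Φ_∞` has the slope limit `Φ′` at `t₀` in `𝒮((F ⊗ ℝ)ⁿ)` then `t ↦ θ_Φ(γ(t), g_f)` is differentiable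
at `t₀` with derivative `Λ_{ω_f(g_f)Φ_f}(Φ′) = Θ(Φ′ ⊗ ω_f(g_f)Φ_f)` — i.e. `R(X) θ_Φ = θ_{dω(X)Φ}` once the
archimedean orbit maps are differentiated in `𝒮` (for the oscillator torus this is
`HermiteMultiplierDerivative.tendsto_slope_torusOpCLM`).  Everything is kernel-proved; Weil 1964 n° 41 is the
source of the majorant argument.
-/

noncomputable section

open scoped BigOperators Topology Classical SchwartzMap TensorProduct
open NumberField NumberField.mixedEmbedding IsDedekindDomain Set Filter

namespace Literature.NumberTheory.Weil1964

open Literature.NumberTheory.Automorphic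

variable {F : Type} [Field F] [NumberField F] {n : ℕ}

/-! ## §1  The archimedean slice functional `Λ_{Ψ_f}` -/

section Slice

/-- Decay of an archimedean Schwartz function from its seminorms of index `≤ (k, 0)` (the `ℂ`-seminorm form of
Mathlib's `SchwartzMap.one_add_le_sup_seminorm_apply`). [folklore] -/
theorem norm_le_two_pow_mul_sup_seminorm_mul_rpow_neg (Φ : 𝓢((Fin n → mixedSpace F), ℂ)) (k : ℕ)
    (z : Fin n → mixedSpace F) :
    ‖Φ z‖ ≤ 2 ^ k * (Finset.Iic (k, 0)).sup (schwartzSeminormFamily ℂ (Fin n → mixedSpace F) ℂ) Φ *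
      (1 + ‖z‖) ^ (-(k : ℝ)) := by
  have h := SchwartzMap.one_add_le_sup_seminorm_apply (𝕜 := ℂ) (m := (k, 0)) le_rfl le_rfl Φ z
  rw [norm_iteratedFDeriv_zero] at h
  have hpos : 0 < 1 + ‖z‖ := by positivity
  rw [Real.rpow_neg hpos.le, Real.rpow_natCast, ← div_eq_mul_inv, le_div_iff₀ (pow_pos hpos k), mul_comm]
  exact h

variable (F n)

/-- **The archimedean slice of the theta distribution** at a finite factor `Ψ_f`, as a linear functional
`Φ_∞ ↦ Θ(Φ_∞ ⊗ Ψ_f)` on `𝒮((F ⊗ ℝ)ⁿ)`. [folklore] -/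
def thetaSliceₗ (Ψf : FinSB F (Fin n)) : 𝓢((Fin n → mixedSpace F), ℂ) →ₗ[ℂ] ℂ :=
  thetaDistLM F (Fin n) ∘ₗ (piSchwartzBruhatEquiv F (Fin n)).toLinearMap ∘ₗ
    (TensorProduct.mk ℂ 𝓢((Fin n → mixedSpace F), ℂ) (FinSB F (Fin n))).flip Ψf

variable {F n}

/-- Unfolding: `Λ_{Ψ_f}(Φ_∞) = Θ(Φ_∞ ⊗ Ψ_f)`. [folklore] -/
theorem thetaSliceₗ_apply (Ψf : FinSB F (Fin n)) (Φ : 𝓢((Fin n → mixedSpace F), ℂ)) :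
    thetaSliceₗ F n Ψf Φ = thetaDistLM F (Fin n) (piSchwartzBruhatEquiv F (Fin n) (Φ ⊗ₜ Ψf)) := rfl

/-- `Λ_{Ψ_f}(Φ_∞) = Σ_{ξ ∈ Fⁿ} Φ_∞(ξ_∞) Ψ_f(ξ_f)`. [folklore] -/
theorem thetaSliceₗ_apply_eq_tsum (Ψf : FinSB F (Fin n)) (Φ : 𝓢((Fin n → mixedSpace F), ℂ)) :
    thetaSliceₗ F n Ψf Φ = ∑' ξ : Fin n → F,
      Φ (piArch F (Fin n) (ratPt F (Fin n) ξ)) *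
        (Ψf : (Fin n → FiniteAdeleRing (𝓞 F) F) → ℂ) (piFinite F (Fin n) (ratPt F (Fin n) ξ)) := by
  rw [thetaSliceₗ_apply, thetaDistLM_apply, coe_piSchwartzBruhatEquiv_tmul, thetaDist_def]

/-- **The slice bound (Weil's Lemme 5 for a fixed finite factor)**: with `k = ⌊n[F:ℚ]⌋ + 1` there is
`C = C(Ψ_f) ≥ 0` with `|Θ(Φ_∞ ⊗ Ψ_f)| ≤ C · sup_{m ≤ (k,0)} p_m(Φ_∞)` for all `Φ_∞ ∈ 𝒮((F ⊗ ℝ)ⁿ)`.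
[cite: Weil1964, Chap. III n° 41, Lemme 5 p. 194] -/
theorem exists_norm_thetaSliceₗ_le (Ψf : FinSB F (Fin n)) :
    ∃ C : ℝ, 0 ≤ C ∧ ∀ Φ : 𝓢((Fin n → mixedSpace F), ℂ),
      ‖thetaSliceₗ F n Ψf Φ‖ ≤ C * (Finset.Iic (⌊(n : ℝ) * Module.finrank ℚ F⌋₊ + 1, 0)).sup
        (schwartzSeminormFamily ℂ (Fin n → mixedSpace F) ℂ) Φ := by
  set k : ℕ := ⌊(n : ℝ) * Module.finrank ℚ F⌋₊ + 1 with hk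
  have hk' : (n : ℝ) * Module.finrank ℚ F < k := by
    rw [hk, Nat.cast_add, Nat.cast_one]
    exact Nat.lt_floor_add_one _
  -- the finite factor: bounded, compactly supported
  obtain ⟨Ψ, hΨ⟩ := Ψf
  obtain ⟨hlc, hcs⟩ := (mem_schwartzBruhat_iff).1 hΨ
  obtain ⟨Mf, hMf⟩ := hlc.continuous.bounded_above_of_compact_support hcs
  have hMf0 : 0 ≤ Mf := (norm_nonneg _).trans (hMf 0)
  -- ONE summable majorant for all functions of decay constant `1` supported over `tsupport Ψ`
  obtain ⟨u, hu, hle⟩ := exists_summable_majorant_of_decay F (zero_le_one) k hcs hk' le_rfl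
  have hu0 : ∀ ξ, 0 ≤ u ξ := fun ξ => by
    have h := hle 0 (fun x => by
      rw [Pi.zero_apply, norm_zero, one_mul]
      exact Real.rpow_nonneg (by positivity) _) (fun x _ => rfl) ξ
    rwa [Pi.zero_apply, norm_zero] at h
  set U : ℝ := ∑' ξ : Fin n → F, u ξ with hU
  have hU0 : 0 ≤ U := tsum_nonneg hu0
  set S := (Finset.Iic (k, 0)).sup (schwartzSeminormFamily ℂ (Fin n → mixedSpace F) ℂ) with hS
  refine ⟨2 ^ k * Mf * U, by positivity, fun Φ => ?_⟩
  -- the adelic function `Φ ⊗ Ψ` and its decay constant `q`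
  set q : ℝ := 2 ^ k * S Φ * Mf with hq
  have hq0 : 0 ≤ q := by positivity
  set G : (Fin n → AdeleRing (𝓞 F) F) → ℂ :=
    fun v => Φ (piArch F (Fin n) v) * Ψ (piFinite F (Fin n) v) with hG
  have hGmem : G ∈ piSchwartzBruhat F (Fin n) := tensor_mem_piSchwartzBruhat Φ hΨ
  have hGdec : ∀ x, ‖G x‖ ≤ q * (1 + ‖vecInfinitePart F n x‖) ^ (-(k : ℝ)) := fun x => by
    rw [hG, norm_mul]
    calc ‖Φ (piArch F (Fin n) x)‖ * ‖Ψ (piFinite F (Fin n) x)‖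
        ≤ 2 ^ k * S Φ * (1 + ‖vecInfinitePart F n x‖) ^ (-(k : ℝ)) * Mf :=
          mul_le_mul (norm_le_two_pow_mul_sup_seminorm_mul_rpow_neg Φ k _) (hMf _) (norm_nonneg _)
            (mul_nonneg (by positivity) (Real.rpow_nonneg (by positivity) _))
      _ = q * (1 + ‖vecInfinitePart F n x‖) ^ (-(k : ℝ)) := by rw [hq]; ring
  have hGsupp : ∀ x, vecFinitePart F n x ∉ tsupport Ψ → G x = 0 := fun x hx => by
    rw [hG]
    beta_reduce
    rw [show piFinite F (Fin n) x = vecFinitePart F n x from rfl, image_eq_zero_of_notMem_tsupport hx, mul_zero]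
  -- `‖G(ξ)‖ ≤ q u(ξ)` by scaling to decay constant `1`
  have hGle : ∀ ξ : Fin n → F, ‖G (ratPt F (Fin n) ξ)‖ ≤ q * u ξ := fun ξ => by
    rcases hq0.eq_or_lt with hq00 | hqpos
    · have h0 : ∀ x, G x = 0 := fun x => by
        have h := hGdec x
        rw [← hq00, zero_mul] at h
        exact norm_le_zero_iff.1 h
      rw [h0, norm_zero, ← hq00, zero_mul]
    · have hdec' : ∀ x, ‖(q⁻¹ : ℂ) * G x‖ ≤ 1 * (1 + ‖vecInfinitePart F n x‖) ^ (-(k : ℝ)) := fun x => by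
        rw [norm_mul, norm_inv, Complex.norm_real, Real.norm_of_nonneg hq0, one_mul,
          inv_mul_le_iff₀ hqpos]
        exact hGdec x
      have hsupp' : ∀ x, vecFinitePart F n x ∉ tsupport Ψ → (q⁻¹ : ℂ) * G x = 0 := fun x hx => by
        rw [hGsupp x hx, mul_zero]
      have h := hle (fun x => (q⁻¹ : ℂ) * G x) hdec' hsupp' ξ
      rw [norm_mul, norm_inv, Complex.norm_real, Real.norm_of_nonneg hq0, inv_mul_le_iff₀ hqpos] at h
      exact h
  -- sum up
  have hsum : Summable fun ξ : Fin n → F => ‖G (ratPt F (Fin n) ξ)‖ := summable_norm_ratPt hGmem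
  calc ‖thetaSliceₗ F n ⟨Ψ, hΨ⟩ Φ‖ = ‖thetaDist F (Fin n) G‖ := by
        rw [thetaSliceₗ_apply, thetaDistLM_apply, coe_piSchwartzBruhatEquiv_tmul]
    _ ≤ ∑' ξ : Fin n → F, ‖G (ratPt F (Fin n) ξ)‖ := norm_thetaDist_le hGmem
    _ ≤ ∑' ξ : Fin n → F, q * u ξ := hsum.tsum_le_tsum hGle (hu.mul_left q)
    _ = q * U := by rw [tsum_mul_left]
    _ = 2 ^ k * Mf * U * S Φ := by rw [hq]; ring

variable (F n)

/-- **The archimedean slice functional `Λ_{Ψ_f} : 𝒮((F ⊗ ℝ)ⁿ) →L[ℂ] ℂ`**, `Φ_∞ ↦ Θ(Φ_∞ ⊗ Ψ_f)` — continuous by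
the slice bound. [cite: Weil1964, Chap. III n° 41, Lemme 5 p. 194] -/
def thetaSliceCLM (Ψf : FinSB F (Fin n)) : 𝓢((Fin n → mixedSpace F), ℂ) →L[ℂ] ℂ :=
  SchwartzMap.mkCLMtoNormedSpace (thetaSliceₗ F n Ψf) (fun Φ Φ' => map_add _ Φ Φ')
    (fun a Φ => by simp only [map_smul, RingHom.id_apply])
    (by
      obtain ⟨C, hC0, hC⟩ := exists_norm_thetaSliceₗ_le Ψf
      exact ⟨_, C, hC0, hC⟩)

variable {F n}

/-- Unfolding: `Λ_{Ψ_f}(Φ_∞) = Θ(Φ_∞ ⊗ Ψ_f)`. [folklore] -/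
@[simp] theorem thetaSliceCLM_apply (Ψf : FinSB F (Fin n)) (Φ : 𝓢((Fin n → mixedSpace F), ℂ)) :
    thetaSliceCLM F n Ψf Φ = thetaDistLM F (Fin n) (piSchwartzBruhatEquiv F (Fin n) (Φ ⊗ₜ Ψf)) := rfl

/-- `Λ_{Ψ_f}(Φ_∞) = Σ_{ξ ∈ Fⁿ} Φ_∞(ξ_∞) Ψ_f(ξ_f)`. [folklore] -/
theorem thetaSliceCLM_apply_eq_tsum (Ψf : FinSB F (Fin n)) (Φ : 𝓢((Fin n → mixedSpace F), ℂ)) :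
    thetaSliceCLM F n Ψf Φ = ∑' ξ : Fin n → F,
      Φ (piArch F (Fin n) (ratPt F (Fin n) ξ)) *
        (Ψf : (Fin n → FiniteAdeleRing (𝓞 F) F) → ℂ) (piFinite F (Fin n) (ratPt F (Fin n) ξ)) :=
  thetaSliceₗ_apply_eq_tsum Ψf Φ

/-- **Continuity of `Φ_∞ ↦ Θ(Φ_∞ ⊗ Ψ_f)`** in the Schwartz topology. [cite: Weil1964, Chap. III n° 41, Lemme 5 p. 194] -/
theorem continuous_thetaDistLM_tmul_left (Ψf : FinSB F (Fin n)) :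
    Continuous fun Φ : 𝓢((Fin n → mixedSpace F), ℂ) =>
      thetaDistLM F (Fin n) (piSchwartzBruhatEquiv F (Fin n) (Φ ⊗ₜ Ψf)) :=
  (thetaSliceCLM F n Ψf).continuous

/-- The slice is also linear in the finite factor: `Λ_{Ψ_f + Ψ_f′} = Λ_{Ψ_f} + Λ_{Ψ_f′}`. [folklore] -/
theorem thetaSliceCLM_add (Ψf Ψf' : FinSB F (Fin n)) :
    thetaSliceCLM F n (Ψf + Ψf') = thetaSliceCLM F n Ψf + thetaSliceCLM F n Ψf' := by
  ext Φ
  simp only [thetaSliceCLM_apply, add_apply, TensorProduct.tmul_add, map_add]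

/-- `Λ_{c Ψ_f} = c Λ_{Ψ_f}`. [folklore] -/
theorem thetaSliceCLM_smul (c : ℂ) (Ψf : FinSB F (Fin n)) :
    thetaSliceCLM F n (c • Ψf) = c • thetaSliceCLM F n Ψf := by
  ext Φ
  simp only [thetaSliceCLM_apply, smul_apply, TensorProduct.tmul_smul, map_smul]

end Slice

/-! ## §2  Theta kernels of `ω_∞ ⊗ ω_f` and differentiation along the archimedean group -/

section Kernel

variable {Ginf : Type*} {Gfin : Type*} [Monoid Ginf] [Monoid Gfin]

/-- **The theta kernel at a pure tensor is the slice functional of the archimedean orbit**: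
`Θ(ω(g_∞, g_f)(Φ_∞ ⊗ Φ_f)) = Λ_{ω_f(g_f)Φ_f}(ω_∞(g_∞)Φ_∞)`. [folklore] -/
theorem thetaDistLM_adelicRep_tmul (ωinf : Representation ℂ Ginf 𝓢((Fin n → mixedSpace F), ℂ))
    (ωfin : Representation ℂ Gfin (FinSB F (Fin n))) (g : Ginf × Gfin)
    (Φinf : 𝓢((Fin n → mixedSpace F), ℂ)) (Φfin : FinSB F (Fin n)) :
    thetaDistLM F (Fin n) (adelicRep ωinf ωfin g (piSchwartzBruhatEquiv F (Fin n) (Φinf ⊗ₜ Φfin))) =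
      thetaSliceCLM F n (ωfin g.2 Φfin) (ωinf g.1 Φinf) := by
  rw [adelicRep_apply_tmul, thetaSliceCLM_apply]

/-- **A continuous linear functional maps slope limits to derivatives**: if `t ↦ c(t)` has the slope limit
`c′` at `t₀` in a topological vector space `E` (e.g. `𝒮`), then `t ↦ Λ(c(t))` has derivative `Λ(c′)` at `t₀`.
[folklore] -/
theorem hasDerivAt_comp_of_tendsto_slope {E : Type*} [AddCommGroup E] [Module ℝ E] [Module ℂ E]
    [TopologicalSpace E] [IsScalarTower ℝ ℂ E] (Λ : E →L[ℂ] ℂ) {c : ℝ → E} {c' : E} {t₀ : ℝ}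
    (hc : Tendsto (slope c t₀) (𝓝[≠] t₀) (𝓝 c')) :
    HasDerivAt (fun t => Λ (c t)) (Λ c') t₀ := by
  rw [hasDerivAt_iff_tendsto_slope]
  have h : slope (fun t => Λ (c t)) t₀ = fun t => Λ (slope c t₀ t) := by
    funext t
    rw [slope_def_module, slope_def_module, Λ.map_smul_of_tower, map_sub]
  rw [h]
  exact (Λ.continuous.tendsto c').comp hc

/-- **Differentiation of the slice along a curve**: a slope limit `Φ′` of `t ↦ c(t)` in `𝒮((F ⊗ ℝ)ⁿ)` gives
`d/dt Θ(c(t) ⊗ Ψ_f) = Θ(Φ′ ⊗ Ψ_f)`. [folklore] -/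
theorem hasDerivAt_thetaSliceCLM_comp (Ψf : FinSB F (Fin n)) {c : ℝ → 𝓢((Fin n → mixedSpace F), ℂ)}
    {Φ' : 𝓢((Fin n → mixedSpace F), ℂ)} {t₀ : ℝ} (hc : Tendsto (slope c t₀) (𝓝[≠] t₀) (𝓝 Φ')) :
    HasDerivAt (fun t => thetaSliceCLM F n Ψf (c t)) (thetaSliceCLM F n Ψf Φ') t₀ :=
  hasDerivAt_comp_of_tendsto_slope (thetaSliceCLM F n Ψf) hc

/-- **Differentiation of theta kernels along one-parameter families in the archimedean group.** For
`ω = ω_∞ ⊗ ω_f`, a pure tensor `Φ_∞ ⊗ Φ_f`, `g_f ∈ G_f` and a curve `γ : ℝ → G_∞`: if the archimedean orbit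
`t ↦ ω_∞(γ(t))Φ_∞` has the slope limit `Φ′` at `t₀` IN `𝒮((F ⊗ ℝ)ⁿ)`, then
`t ↦ θ(γ(t), g_f) = Θ(ω(γ(t), g_f)(Φ_∞ ⊗ Φ_f))` is differentiable at `t₀` with derivative
`Θ(Φ′ ⊗ ω_f(g_f)Φ_f)` — the identity `R(X)θ_Φ = θ_{dω(X)Φ}` behind the holomorphy / weight computations, with
the archimedean differentiation supplied separately (e.g. `tendsto_slope_torusOpCLM` of
`HermiteMultiplierDerivative` for the oscillator torus). [folklore] -/
theorem hasDerivAt_thetaDistLM_adelicRep_tmul (ωinf : Representation ℂ Ginf 𝓢((Fin n → mixedSpace F), ℂ))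
    (ωfin : Representation ℂ Gfin (FinSB F (Fin n))) (γ : ℝ → Ginf) (gf : Gfin)
    (Φinf : 𝓢((Fin n → mixedSpace F), ℂ)) (Φfin : FinSB F (Fin n))
    {Φ' : 𝓢((Fin n → mixedSpace F), ℂ)} {t₀ : ℝ}
    (hc : Tendsto (slope (fun t => ωinf (γ t) Φinf) t₀) (𝓝[≠] t₀) (𝓝 Φ')) :
    HasDerivAt
      (fun t => thetaDistLM F (Fin n)
        (adelicRep ωinf ωfin (γ t, gf) (piSchwartzBruhatEquiv F (Fin n) (Φinf ⊗ₜ Φfin))))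
      (thetaSliceCLM F n (ωfin gf Φfin) Φ') t₀ := by
  simp_rw [thetaDistLM_adelicRep_tmul]
  exact hasDerivAt_thetaSliceCLM_comp (ωfin gf Φfin) hc

/-- The same along the archimedean factor alone (`g_f = 1`): derivative `Θ(Φ′ ⊗ Φ_f)`. [folklore] -/
theorem hasDerivAt_thetaDistLM_adelicRep_tmul_one (ωinf : Representation ℂ Ginf 𝓢((Fin n → mixedSpace F), ℂ))
    (ωfin : Representation ℂ Gfin (FinSB F (Fin n))) (γ : ℝ → Ginf)
    (Φinf : 𝓢((Fin n → mixedSpace F), ℂ)) (Φfin : FinSB F (Fin n))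
    {Φ' : 𝓢((Fin n → mixedSpace F), ℂ)} {t₀ : ℝ}
    (hc : Tendsto (slope (fun t => ωinf (γ t) Φinf) t₀) (𝓝[≠] t₀) (𝓝 Φ')) :
    HasDerivAt
      (fun t => thetaDistLM F (Fin n)
        (adelicRep ωinf ωfin (γ t, 1) (piSchwartzBruhatEquiv F (Fin n) (Φinf ⊗ₜ Φfin))))
      (thetaSliceCLM F n Φfin Φ') t₀ := by
  have h := hasDerivAt_thetaDistLM_adelicRep_tmul ωinf ωfin γ 1 Φinf Φfin hc
  rwa [map_one, Module.End.one_apply] at h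

/-- **Continuity transfer** (the order-zero case, for comparison with F6): if `t ↦ ω_∞(γ(t))Φ_∞` is continuous
into `𝒮` then `t ↦ θ(γ(t), g_f)` is continuous. [folklore] -/
theorem continuous_thetaDistLM_adelicRep_tmul {T : Type*} [TopologicalSpace T]
    (ωinf : Representation ℂ Ginf 𝓢((Fin n → mixedSpace F), ℂ))
    (ωfin : Representation ℂ Gfin (FinSB F (Fin n))) (γ : T → Ginf) (gf : Gfin)
    (Φinf : 𝓢((Fin n → mixedSpace F), ℂ)) (Φfin : FinSB F (Fin n))
    (hc : Continuous fun t => ωinf (γ t) Φinf) :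
    Continuous fun t => thetaDistLM F (Fin n)
      (adelicRep ωinf ωfin (γ t, gf) (piSchwartzBruhatEquiv F (Fin n) (Φinf ⊗ₜ Φfin))) := by
  simp_rw [thetaDistLM_adelicRep_tmul]
  exact (thetaSliceCLM F n (ωfin gf Φfin)).continuous.comp hc

end Kernel

end Literature.NumberTheory.Weil1964

end
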